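/-
Copyright (c) 2026 the pub-hodgecm-mathlib formalisation cell (harness21).  Prover seat hodgecm-mathlib-LH7-p04 (g3), 2026-09-02 (LH7 leaf ED. 3 road,
O8b census residual (iii) «archimedean places»: weak approximation at `∞` ⇒ `U(J)(𝔸_{F,f})` has dense orbit on `U(J)(F) \ U(J)(𝔸_F)` ⇒
ergodicity and «`U(J)(𝔸_{F,f})`-eigen ⇒ automorphic character»).
-/
import Literature.NumberTheory.Automorphic.UnitaryGroupAdelicProduct
import Literature.NumberTheory.Automorphic.AutomorphicCharacterLineSubgroup
import HarnessLib

/-!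
# The finite-adelic group `U(J)(𝔸_{F,f})` of a unitary group: normal, closed, and — under weak approximation at the archimedean places —
# with dense orbit on the automorphic quotient; consequences for `L²(U(J)(F) \ U(J)(𝔸_F))`

Topic `NumberTheory/Automorphic`; namespace `Literature.NumberTheory.Automorphic.UnitaryGroup`; THEOREMS ONLY (no definition, no instance, no named
fact, no notation, no `sorry`).  Companion of ★ `UnitaryGroupAdelicProduct` (`U(J)(𝔸_F) ≃ₜ* U(J)(E ⊗ ℝ) × U(J)(𝔸_{F,f})`, `archPart`, `finPart`,
`ker_archPart = finiteAdelic`) and of ★ `AutomorphicQuotientSubgroupErgodic` ∕ ★ `AutomorphicCharacterLineSubgroup` (Moore's ergodicity lemma for a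
closed normal subgroup `M ≤ G(𝔸_K)` with `M · (A_G · G(K))` dense, and its `L²` consequences).

For a quadratic extension `E/F` of number fields, `c ∈ Gal(E/F)`, `J ∈ M_N(E)` and the datum `𝒢 = adelicGroupData F E c N J` (`A_G = 1`):
* §1 `normal_finiteAdelic`, `isClosed_finiteAdelic` — `U(J)(𝔸_{F,f}) = ker (g ↦ g_∞)` is a closed normal subgroup of `U(J)(𝔸_F)`;
  **`dense_finiteAdelic_mul_arithmeticSubgroup_of_denseRange`** — if `U(J)(F)` is DENSE in `U(J)(E ⊗ ℝ)` (WEAK APPROXIMATION at the archimedean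
  places, hypothesis `DenseRange (g ↦ (toAdelic g)_∞)`), then `U(J)(𝔸_{F,f}) · U(J)(F)` is dense in `U(J)(𝔸_F)` (given `g = (g_∞, g_f)` and an
  open `U ∋ g`, pick `γ ∈ U(J)(F)` with `(γ_∞, g_f) ∈ U`; then `(γ_∞, g_f) = [(γ_∞, g_f) γ⁻¹] · γ` with `[(γ_∞, g_f) γ⁻¹]_∞ = 1`);
  `dense_finiteAdelic_mul_quotientSubgroup_of_denseRange` (the form ★ Moore's lemma consumes).
* §2 (with `U(J)(𝔸_F)` locally compact second countable and an automorphic measure `μ`, under the weak-approximation hypothesis)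
  `ergodicSMul_finiteAdelic_automorphicQuotient` — **`U(J)(𝔸_{F,f})` acts ergodically on `U(J)(F) \ U(J)(𝔸_F)`**;
  `ae_eq_const_of_forall_rightRegular_finAdelicToAdelic_apply_eq` — an `L²` automorphic function fixed by `R(1, g_f)` for all `g_f` is a.e. constant;
  `AutomorphicCharacter.mem_lineSubrep_of_forall_rightRegular_finAdelicToAdelic_apply_eq_smul` — an `L²` automorphic function with
  `R(1, g_f) f = ψ(1, g_f)⁻¹ f` for all `g_f` lies in the line `ℂ [ψ̄]`;
  **`DiscreteAutomorphicRep.eq_ofChar_of_forall_finAdelicToAdelic_apply_eq_smul`** — a discrete automorphic representation of `U(J)` on which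
  `U(J)(𝔸_{F,f})` acts by the scalars `ψ(1, g_f)⁻¹` IS `ofChar ψ μ` (so one-dimensional, `isOneDimensional_of_forall_finAdelicToAdelic_apply_eq_smul`,
  and ALL of `U(J)(𝔸_F)` acts by `ψ⁻¹`).

CONSUMER (cell `hodgecm-mathlib`, crux H413 = stmt-HodgeConjecture-24833, line LH7, leaf ED. 3 print organ O8b `PKmultOneU2Shape`): ★
`DiscreteAutomorphicRepFinAdelicScalar` (LH7-p01 (g3)) proves «`Realises₂ P₂ ξ` + local isotypy ⇒ `U(Φ₂)(𝔸_{L⁺,f})` acts on `P₂` by the character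
`((η ψ) ∘ det)`»; with §2 this gives `P₂ = ofChar ((η ψ) ∘ det)⁻¹ μ₂` CONDITIONALLY on weak approximation at `∞` for `U(Φ₂)` («`U(Φ₂)(L⁺)` is dense in
`U(Φ₂)(L⁺ ⊗ ℝ)`», [PlatonovRapinchuk1994] §7.3 Prop. 7.8 — every connected group over a number field has weak approximation at the archimedean
places), which is therefore the ONE remaining input of residual (iii) of the O8b census (`F0/P3a/F0P3a-p03/g20/CENSUS-O8b-PKmultOneU2.F0P3ap03g20.md`).
HONEST LABEL: generic adelic bookkeeping; HC_CM is proved only modulo the printed citations of that programme until its rung 0 closes; this file proves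
no printed citation of it.

## References
* [PlatonovRapinchuk1994] V. Platonov, A. Rapinchuk, *Algebraic Groups and Number Theory* (1994), §7.3 Prop. 7.8 (weak approximation at `S_∞` for
  connected groups), §5.1 (`G(𝔸) = G_∞ × G(𝔸_f)`).
* [Zimmer1984] R. J. Zimmer, *Ergodic theory and semisimple groups* (1984), §2.2 Cor. 2.2.3 (Moore's ergodicity duality).
* [BorelJacquet1979] A. Borel, H. Jacquet, *Automorphic forms and automorphic representations*, Proc. Sympos. Pure Math. XXXIII.1 (1979), §4.1.
-/

set_option autoImplicit false

noncomputable section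

open MeasureTheory Filter Set Topology NumberField
open scoped Pointwise

namespace Literature.NumberTheory.Automorphic

namespace UnitaryGroup

variable (F E : Type) [Field F] [NumberField F] [Field E] [NumberField E] [Algebra F E]
  (c : E ≃ₐ[F] E) (N : ℕ) (J : Matrix (Fin N) (Fin N) E)

/-! ## §1 `U(J)(𝔸_{F,f}) ⊴ U(J)(𝔸_F)` is closed, and has dense orbit on the automorphic quotient under weak approximation at `∞` -/

/-- **`U(J)(𝔸_{F,f})` is a normal subgroup of `U(J)(𝔸_F)`**: it is the kernel of the archimedean component `g ↦ g_∞` (★ `ker_archPart`).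
[cite: BorelJacquet1979, §4.1] -/
theorem normal_finiteAdelic : (finiteAdelic F E c N J).Normal := by
  rw [← ker_archPart F E c N J]
  infer_instance

/-- **`U(J)(𝔸_{F,f})` is closed in `U(J)(𝔸_F)`**: the kernel of the continuous `g ↦ g_∞` into the Hausdorff group `U(J)(E ⊗ ℝ) ≤ GL_N(E ⊗ ℝ)`.
[cite: BorelJacquet1979, §4.1] -/
theorem isClosed_finiteAdelic : IsClosed (finiteAdelic F E c N J : Set (adelicGroupData F E c N J).Adelic) := by
  rw [← ker_archPart F E c N J, MonoidHom.coe_ker]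
  exact isClosed_singleton.preimage (continuous_archPart F E c N J)

/-- **Weak approximation at `∞` ⇒ `U(J)(𝔸_{F,f}) · U(J)(F)` is dense in `U(J)(𝔸_F)`.**  If the rational points `U(J)(F)` are dense in the
archimedean group `U(J)(E ⊗ ℝ)` (hypothesis `hWA`, [PlatonovRapinchuk1994] §7.3 Prop. 7.8), then the product set of the finite-adelic subgroup and the
arithmetic subgroup is dense: for `g = (g_∞, g_f)` and an open `U ∋ g`, the continuous `a ↦ (a, 1) · (1, g_f)` pulls `U` back to an open
neighbourhood of `g_∞`, which contains some `γ_∞`, `γ ∈ U(J)(F)`; then `x = (γ_∞, 1) · (1, g_f) ∈ U` and `x = (x γ⁻¹) · γ` with `(x γ⁻¹)_∞ = 1`.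
[cite: PlatonovRapinchuk1994, §7.3 Prop. 7.8] -/
theorem dense_finiteAdelic_mul_arithmeticSubgroup_of_denseRange
    (hWA : DenseRange fun γ : (adelicGroupData F E c N J).Rational =>
      archPart F E c N J ((adelicGroupData F E c N J).toAdelic γ)) :
    Dense ((finiteAdelic F E c N J : Set (adelicGroupData F E c N J).Adelic) *
      ((adelicGroupData F E c N J).arithmeticSubgroup : Set (adelicGroupData F E c N J).Adelic)) := by
  rw [dense_iff_inter_open]
  rintro U hU ⟨g, hg⟩
  set φ : arch F E c N J → (adelicGroupData F E c N J).Adelic := fun a =>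
    archToAdelic F E c N J a * finAdelicToAdelic F E c N J (finPart F E c N J g) with hφ
  have hφc : Continuous φ := (continuous_archToAdelic F E c N J).mul continuous_const
  have hφg : φ (archPart F E c N J g) = g := archToAdelic_mul_finAdelicToAdelic F E c N J g
  have hne : (φ ⁻¹' U).Nonempty := ⟨archPart F E c N J g, by rw [mem_preimage, hφg]; exact hg⟩
  obtain ⟨γ, hγ⟩ := hWA.exists_mem_open (hU.preimage hφc) hne
  rw [mem_preimage] at hγ
  set t : (adelicGroupData F E c N J).Adelic := (adelicGroupData F E c N J).toAdelic γ with ht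
  refine ⟨φ (archPart F E c N J t), hγ, ?_⟩
  rw [← inv_mul_cancel_right (φ (archPart F E c N J t)) t]
  refine Set.mul_mem_mul ?_ ⟨γ, rfl⟩
  rw [← ker_archPart F E c N J, SetLike.mem_coe, MonoidHom.mem_ker]
  simp only [hφ, map_mul, map_inv, archPart_archToAdelic, archPart_finAdelicToAdelic, mul_one, mul_inv_cancel]

/-- **Weak approximation at `∞` ⇒ `U(J)(𝔸_{F,f}) · (A_G · U(J)(F))` is dense in `U(J)(𝔸_F)`** — the density hypothesis of ★ Moore's lemma
`AdelicGroupData.ergodicSMul_subgroup_automorphicQuotient` for `M = U(J)(𝔸_{F,f})` (`A_G = 1` for unitary data, so this is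
`dense_finiteAdelic_mul_arithmeticSubgroup_of_denseRange` up to the inclusion `U(J)(F) ≤ A_G · U(J)(F)`). [cite: PlatonovRapinchuk1994, §7.3 Prop. 7.8] -/
theorem dense_finiteAdelic_mul_quotientSubgroup_of_denseRange
    (hWA : DenseRange fun γ : (adelicGroupData F E c N J).Rational =>
      archPart F E c N J ((adelicGroupData F E c N J).toAdelic γ)) :
    Dense ((finiteAdelic F E c N J : Set (adelicGroupData F E c N J).Adelic) *
      ((adelicGroupData F E c N J).quotientSubgroup : Set (adelicGroupData F E c N J).Adelic)) :=
  (dense_finiteAdelic_mul_arithmeticSubgroup_of_denseRange F E c N J hWA).mono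
    (Set.mul_subset_mul_left (SetLike.coe_subset_coe.2 (adelicGroupData F E c N J).arithmeticSubgroup_le_quotientSubgroup))

/-! ## §2 Consequences in `L²(U(J)(F) \ U(J)(𝔸_F))` under weak approximation at `∞` -/

section L2

variable [LocallyCompactSpace (adelicGroupData F E c N J).Adelic] [SecondCountableTopology (adelicGroupData F E c N J).Adelic]
  (μ : Measure (adelicGroupData F E c N J).automorphicQuotient) [(adelicGroupData F E c N J).IsAutomorphicMeasure μ]

/-- **Under weak approximation at `∞`, `U(J)(𝔸_{F,f})` acts ergodically on the automorphic quotient `U(J)(F) \ U(J)(𝔸_F)`** (★ Moore's lemma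
`AdelicGroupData.ergodicSMul_subgroup_automorphicQuotient` for the closed normal subgroup `finiteAdelic`, its density hypothesis being
`dense_finiteAdelic_mul_quotientSubgroup_of_denseRange`). [cite: Zimmer1984, §2.2 Cor. 2.2.3] -/
theorem ergodicSMul_finiteAdelic_automorphicQuotient
    (hWA : DenseRange fun γ : (adelicGroupData F E c N J).Rational =>
      archPart F E c N J ((adelicGroupData F E c N J).toAdelic γ)) :
    ErgodicSMul (finiteAdelic F E c N J) (adelicGroupData F E c N J).automorphicQuotient μ := by
  haveI := normal_finiteAdelic F E c N J
  exact (adelicGroupData F E c N J).ergodicSMul_subgroup_automorphicQuotient μ (finiteAdelic F E c N J)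
    (isClosed_finiteAdelic F E c N J) (dense_finiteAdelic_mul_quotientSubgroup_of_denseRange F E c N J hWA)

/-- **Under weak approximation at `∞`, an `L²` automorphic function of `U(J)` fixed by `R(1, g_f)` for every `g_f ∈ U(J)(𝔸_{F,f})` is a.e.
constant** (★ `AdelicGroupData.ae_eq_const_of_forall_mem_rightRegular_apply_eq` with `M = finiteAdelic = range finAdelicToAdelic`).
[cite: Zimmer1984, §2.2 Cor. 2.2.3] -/
theorem ae_eq_const_of_forall_rightRegular_finAdelicToAdelic_apply_eq
    (hWA : DenseRange fun γ : (adelicGroupData F E c N J).Rational =>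
      archPart F E c N J ((adelicGroupData F E c N J).toAdelic γ))
    {f : (adelicGroupData F E c N J).L2 μ}
    (hf : ∀ b : finAdelic F E c N J, (adelicGroupData F E c N J).rightRegular μ (finAdelicToAdelic F E c N J b) f = f) :
    ∃ a : ℂ, (f : (adelicGroupData F E c N J).automorphicQuotient → ℂ) =ᵐ[μ] Function.const _ a := by
  haveI := normal_finiteAdelic F E c N J
  refine (adelicGroupData F E c N J).ae_eq_const_of_forall_mem_rightRegular_apply_eq μ (finiteAdelic F E c N J)
    (isClosed_finiteAdelic F E c N J) (dense_finiteAdelic_mul_quotientSubgroup_of_denseRange F E c N J hWA) fun m hm => ?_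
  rw [← range_finAdelicToAdelic F E c N J] at hm
  obtain ⟨b, rfl⟩ := hm
  exact hf b

/-- **Under weak approximation at `∞`, an `L²` automorphic function of `U(J)` with `R(1, g_f) f = ψ(1, g_f)⁻¹ f` for every `g_f ∈ U(J)(𝔸_{F,f})`
lies in the line `ℂ [ψ̄]`** of the automorphic character `ψ` (★ `AutomorphicCharacter.mem_lineSubrep_of_forall_mem_rightRegular_apply_eq_smul`).
[cite: Zimmer1984, §2.2 Cor. 2.2.3] -/
theorem mem_lineSubrep_of_forall_rightRegular_finAdelicToAdelic_apply_eq_smul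
    (hWA : DenseRange fun γ : (adelicGroupData F E c N J).Rational =>
      archPart F E c N J ((adelicGroupData F E c N J).toAdelic γ))
    (ψ : (adelicGroupData F E c N J).AutomorphicCharacter) {f : (adelicGroupData F E c N J).L2 μ}
    (hf : ∀ b : finAdelic F E c N J, (adelicGroupData F E c N J).rightRegular μ (finAdelicToAdelic F E c N J b) f =
      ((ψ (finAdelicToAdelic F E c N J b) : ℂˣ) : ℂ)⁻¹ • f) :
    f ∈ ψ.lineSubrep μ := by
  haveI := normal_finiteAdelic F E c N J
  refine ψ.mem_lineSubrep_of_forall_mem_rightRegular_apply_eq_smul μ (finiteAdelic F E c N J)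
    (isClosed_finiteAdelic F E c N J) (dense_finiteAdelic_mul_quotientSubgroup_of_denseRange F E c N J hWA) fun m hm => ?_
  rw [← range_finAdelicToAdelic F E c N J] at hm
  obtain ⟨b, rfl⟩ := hm
  exact hf b

/-- **Under weak approximation at `∞`, a discrete automorphic representation of `U(J)` on which `U(J)(𝔸_{F,f})` acts by the scalars `ψ(1, g_f)⁻¹`
IS `ofChar ψ μ`** — the line of the automorphic character `ψ̄` (★ `DiscreteAutomorphicRep.eq_ofChar_of_forall_mem_apply_eq_smul`); in particular ALL
of `U(J)(𝔸_F)` acts on it by `ψ⁻¹` (★ `eq_ofChar_iff_forall_apply_eq_smul`).  On line LH7 this is residual (iii) «archimedean places» of the O8b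
census reduced to weak approximation at `∞`. [cite: Zimmer1984, §2.2 Cor. 2.2.3] [cite: PlatonovRapinchuk1994, §7.3 Prop. 7.8] -/
theorem eq_ofChar_of_forall_finAdelicToAdelic_apply_eq_smul
    (hWA : DenseRange fun γ : (adelicGroupData F E c N J).Rational =>
      archPart F E c N J ((adelicGroupData F E c N J).toAdelic γ))
    (P : DiscreteAutomorphicRep (adelicGroupData F E c N J) μ) (ψ : (adelicGroupData F E c N J).AutomorphicCharacter)
    (hP : ∀ (b : finAdelic F E c N J) (v : P.space.toSubmodule),
      P.space.toContRep (finAdelicToAdelic F E c N J b) v = ((ψ (finAdelicToAdelic F E c N J b) : ℂˣ) : ℂ)⁻¹ • v) :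
    P = DiscreteAutomorphicRep.ofChar ψ μ := by
  haveI := normal_finiteAdelic F E c N J
  refine DiscreteAutomorphicRep.eq_ofChar_of_forall_mem_apply_eq_smul μ (finiteAdelic F E c N J)
    (isClosed_finiteAdelic F E c N J) (dense_finiteAdelic_mul_quotientSubgroup_of_denseRange F E c N J hWA) P ψ fun m hm v => ?_
  rw [← range_finAdelicToAdelic F E c N J] at hm
  obtain ⟨b, rfl⟩ := hm
  exact hP b v

/-- **Under weak approximation at `∞`, two discrete automorphic representations of `U(J)` on which `U(J)(𝔸_{F,f})` acts by the same scalars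
`ψ(1, g_f)⁻¹` coincide** (both are `ofChar ψ μ`). [cite: Zimmer1984, §2.2 Cor. 2.2.3] -/
theorem eq_of_forall_finAdelicToAdelic_apply_eq_smul
    (hWA : DenseRange fun γ : (adelicGroupData F E c N J).Rational =>
      archPart F E c N J ((adelicGroupData F E c N J).toAdelic γ))
    (P P' : DiscreteAutomorphicRep (adelicGroupData F E c N J) μ) (ψ : (adelicGroupData F E c N J).AutomorphicCharacter)
    (hP : ∀ (b : finAdelic F E c N J) (v : P.space.toSubmodule),
      P.space.toContRep (finAdelicToAdelic F E c N J b) v = ((ψ (finAdelicToAdelic F E c N J b) : ℂˣ) : ℂ)⁻¹ • v)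
    (hP' : ∀ (b : finAdelic F E c N J) (v : P'.space.toSubmodule),
      P'.space.toContRep (finAdelicToAdelic F E c N J b) v = ((ψ (finAdelicToAdelic F E c N J b) : ℂˣ) : ℂ)⁻¹ • v) :
    P = P' := by
  rw [eq_ofChar_of_forall_finAdelicToAdelic_apply_eq_smul F E c N J μ hWA P ψ hP,
    eq_ofChar_of_forall_finAdelicToAdelic_apply_eq_smul F E c N J μ hWA P' ψ hP']

/-- **Under weak approximation at `∞`, a discrete automorphic representation of `U(J)` on which `U(J)(𝔸_{F,f})` acts by scalars `ψ(1, g_f)⁻¹` is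
one-dimensional.** [cite: Zimmer1984, §2.2 Cor. 2.2.3] -/
theorem isOneDimensional_of_forall_finAdelicToAdelic_apply_eq_smul
    (hWA : DenseRange fun γ : (adelicGroupData F E c N J).Rational =>
      archPart F E c N J ((adelicGroupData F E c N J).toAdelic γ))
    (P : DiscreteAutomorphicRep (adelicGroupData F E c N J) μ) (ψ : (adelicGroupData F E c N J).AutomorphicCharacter)
    (hP : ∀ (b : finAdelic F E c N J) (v : P.space.toSubmodule),
      P.space.toContRep (finAdelicToAdelic F E c N J b) v = ((ψ (finAdelicToAdelic F E c N J b) : ℂˣ) : ℂ)⁻¹ • v) :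
    P.IsOneDimensional := by
  rw [eq_ofChar_of_forall_finAdelicToAdelic_apply_eq_smul F E c N J μ hWA P ψ hP]
  exact DiscreteAutomorphicRep.isOneDimensional_ofChar ψ μ

end L2

end UnitaryGroup

end Literature.NumberTheory.Automorphic
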